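import Mathlib
import HarnessLib

/-!
# Weil-type ladder · prover 3, generation 52 — the Plücker relations behind THEOREM AJ
  (no Abel–Jacobi threefold is a Bloch seed: the algebraic core)

b2b cell `hweil` (HOME `run/shared/lean/b2b/hodge-weil/`), report `b2b-hweil-pv3-g52/ANCHOR.md` §2.
Helper file `--supports stmt-HodgeConjecture-2524` (`WeilSixfolds`); it closes nothing and claims no case of the
Hodge conjecture.  HONEST LABEL: pure linear algebra over a commutative ring (Mathlib only, no definition, no named
fact, no `sorry`); the Hodge-theoretic wrapper (the GRAM IDENTITY below) is pen-and-paper in the report and is NOT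
asserted here; 0 unconditional rungs above the floor; Markman-free.

## Why the cell wants it (context, not kernel content)

The cell target NSC(−2) = `Ring2.AbelianAll.WeilClassesComponent 3 3 [−2]` is reduced in the tree
(`Ring2AbelianAllWeilCellsBlochSeed.weilClassesComponent_of_reachSimilar_of_blochSpread_of_seedInClass`) to two
refereed theorems and ONE object, `HasBlochSeedInClass 3 3 [−2]`: an INTEGRAL Bloch-semiregular lci threefold `Z` on
one polarized member `(P, ψ₀, h)` of the cell whose class is `q·h³ + w` with `w ≠ 0` a Weil class.  For ANY
irreducible threefold `f : Z̃ → P` (resolution of `Z`) the class is encoded by the Hermitian form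
`B_Z(α, β) := [Z]·(α ∧ β̄) = ⟨f^*α, f^*β⟩` on `H^{3,0}(P) = ∧³V` (`V = H^{1,0}(P)`, the pairing on the right being
the positive one on `H^{3,0}(Z̃)`), and `[Z] = q·h³ + w` says: `B_Z` is `q·B_{h³}` (positive, block-diagonal for the
grading `∧³V = ⊕ₐ ∧ᵃV₊ ⊗ ∧³⁻ᵃV₋` by the `K`-eigenspaces) plus ONE off-diagonal corner entry `c` between the lines
`∧³V₊` and `∧³V₋`, and `w ≠ 0 ⟺ c ≠ 0`.  If `Z = F(C^{(3)})` is the image of the symmetric cube of a curve under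
any morphism (Abel–Jacobi and Abel–Prym threefolds, `W₃`-images under isogenies `J(C) → P`, …) then
`H^{3,0}(C^{(3)}) = ∧³H^{1,0}(C)` and `B_Z ∝ ∧³G` for the Gram matrix `G` of `F^* : V → H^{1,0}(C)`: the entries of
`B_Z` are the 3×3 MINORS `det G[S,T]`.  The vanishing of the mixed minors in the rows `A = {1,2,3}` (a basis of `V₊`)
is then incompatible with `det G[A,A]·det G[A,B] ≠ 0` (`B = {4,5,6}`) by the three-term Plücker relation proved below
— so `c = 0`, `w = 0`: NO such threefold carries a Weil component, on any member of any Weil-type sixfold cell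
(THEOREM AJ of the report; the fourfold analogue is the 2×4 relation).  This file proves exactly the two polynomial
identities and their «mixed minors vanish ⟹ p_A·p_B = 0» corollaries.

## Contents (all def-free)

* `plucker_two_four`   — `p₀₁·p₂₃ = p₀₂·p₁₃ − p₀₃·p₁₂` for the 2×2 minors of a 2×4 matrix.
* `plucker_three_six`  — `p₀₁₂·p₃₄₅ = p₀₁₃·p₂₄₅ − p₀₁₄·p₂₃₅ + p₀₁₅·p₂₃₄` for the 3×3 minors of a 3×6 matrix.
* `minor_mul_minor_eq_zero_two_four`, `minor_mul_minor_eq_zero_three_six` — for a square matrix `G`, if the mixed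
  minors of the first rows vanish then `det G[A,A] · det G[A,B] = 0`.
* `minor_AB_eq_zero_three_six` — over a ring without zero divisors, `det G[A,A] ≠ 0` forces `det G[A,B] = 0`.

[folklore] (Plücker relations for the Grassmannians `G(2,4)`, `G(3,6)`; e.g. Griffiths–Harris, Principles, Ch. 1 §5.)
-/

set_option linter.dupNamespace false

namespace Summit.HodgeConjecture.HodgeConjecture.WeilTypeLadder

open Matrix

/-- **Plücker relation for `G(2,4)`**: for a `2 × 4` matrix `M` over a commutative ring, with `p_{ij}` the `2 × 2`
minor on columns `i, j`, one has `p₀₁·p₂₃ = p₀₂·p₁₃ − p₀₃·p₁₂`. [folklore] -/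
theorem plucker_two_four {R : Type*} [CommRing R] (M : Matrix (Fin 2) (Fin 4) R) :
    (M.submatrix id ![0, 1]).det * (M.submatrix id ![2, 3]).det =
      (M.submatrix id ![0, 2]).det * (M.submatrix id ![1, 3]).det -
        (M.submatrix id ![0, 3]).det * (M.submatrix id ![1, 2]).det := by
  simp only [Matrix.det_fin_two, Matrix.submatrix_apply, id]
  simp only [Fin.isValue, Matrix.cons_val_zero, Matrix.cons_val_one]
  ring

/-- **Plücker relation for `G(3,6)`** (the three-term quadratic relation with pivot columns `0, 1`): for a `3 × 6`
matrix `M` over a commutative ring, with `p_{ijk}` the `3 × 3` minor on columns `i, j, k`,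
`p₀₁₂·p₃₄₅ = p₀₁₃·p₂₄₅ − p₀₁₄·p₂₃₅ + p₀₁₅·p₂₃₄`. [folklore] -/
theorem plucker_three_six {R : Type*} [CommRing R] (M : Matrix (Fin 3) (Fin 6) R) :
    (M.submatrix id ![0, 1, 2]).det * (M.submatrix id ![3, 4, 5]).det =
      (M.submatrix id ![0, 1, 3]).det * (M.submatrix id ![2, 4, 5]).det -
        (M.submatrix id ![0, 1, 4]).det * (M.submatrix id ![2, 3, 5]).det +
        (M.submatrix id ![0, 1, 5]).det * (M.submatrix id ![2, 3, 4]).det := by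
  simp only [Matrix.det_fin_three, Matrix.submatrix_apply, id]
  simp only [Fin.isValue, Matrix.cons_val_zero, Matrix.cons_val_one, Matrix.cons_val_two, Matrix.head_cons,
    Matrix.tail_cons]
  ring

/-- **Mixed minors zero ⟹ `p_A·p_B = 0`, format `2 × 4`.** For a `4 × 4` matrix `G` (rows `A = {0,1}`): if the two
mixed minors `det G[A, {0,2}]`, `det G[A, {0,3}]` vanish, then `det G[A,A] · det G[A,B] = 0`, `B = {2,3}`. [folklore] -/
theorem minor_mul_minor_eq_zero_two_four {R : Type*} [CommRing R] (G : Matrix (Fin 4) (Fin 4) R)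
    (h₂ : (G.submatrix ![0, 1] ![0, 2]).det = 0) (h₃ : (G.submatrix ![0, 1] ![0, 3]).det = 0) :
    (G.submatrix ![0, 1] ![0, 1]).det * (G.submatrix ![0, 1] ![2, 3]).det = 0 := by
  have key := plucker_two_four (G.submatrix ![0, 1] id)
  simp only [Matrix.submatrix_submatrix, Function.comp_id, Function.id_comp] at key
  rw [key, h₂, h₃, zero_mul, zero_mul, sub_zero]

/-- **Mixed minors zero ⟹ `p_A·p_B = 0`, format `3 × 6`** (THEOREM AJ's algebraic core). For a `6 × 6` matrix `G`
(rows `A = {0,1,2}`, e.g. the Gram matrix of six holomorphic 1-forms in the basis adapted to the `K`-eigenspaces):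
if the three mixed minors `det G[A, {0,1,3}]`, `det G[A, {0,1,4}]`, `det G[A, {0,1,5}]` vanish, then
`det G[A,A] · det G[A,B] = 0`, `B = {3,4,5}`. [folklore] -/
theorem minor_mul_minor_eq_zero_three_six {R : Type*} [CommRing R] (G : Matrix (Fin 6) (Fin 6) R)
    (h₃ : (G.submatrix ![0, 1, 2] ![0, 1, 3]).det = 0) (h₄ : (G.submatrix ![0, 1, 2] ![0, 1, 4]).det = 0)
    (h₅ : (G.submatrix ![0, 1, 2] ![0, 1, 5]).det = 0) :
    (G.submatrix ![0, 1, 2] ![0, 1, 2]).det * (G.submatrix ![0, 1, 2] ![3, 4, 5]).det = 0 := by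
  have key := plucker_three_six (G.submatrix ![0, 1, 2] id)
  simp only [Matrix.submatrix_submatrix, Function.comp_id, Function.id_comp] at key
  rw [key, h₃, h₄, h₅, zero_mul, zero_mul, zero_mul, sub_zero, add_zero]

/-- **No Weil corner for an Abel–Jacobi Gram matrix** (format `3 × 6`, rings without zero divisors): if the three
mixed minors of the rows `A` vanish and the principal minor `det G[A,A]` is non-zero (for a threefold `Z` with
`[Z] = q·h³ + w` it equals `q·B_{h³}(β₀,β₀)/6 > 0`), then the corner minor `det G[A,B]` — the Weil coefficient — is
zero. [folklore] -/
theorem minor_AB_eq_zero_three_six {R : Type*} [CommRing R] [NoZeroDivisors R] (G : Matrix (Fin 6) (Fin 6) R)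
    (h₃ : (G.submatrix ![0, 1, 2] ![0, 1, 3]).det = 0) (h₄ : (G.submatrix ![0, 1, 2] ![0, 1, 4]).det = 0)
    (h₅ : (G.submatrix ![0, 1, 2] ![0, 1, 5]).det = 0) (hA : (G.submatrix ![0, 1, 2] ![0, 1, 2]).det ≠ 0) :
    (G.submatrix ![0, 1, 2] ![3, 4, 5]).det = 0 :=
  (mul_eq_zero.mp (minor_mul_minor_eq_zero_three_six G h₃ h₄ h₅)).resolve_left hA

/-- **No Weil corner, format `2 × 4`** (surfaces `F(C^{(2)})` in Weil-type abelian fourfolds): mixed minors zero and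
`det G[A,A] ≠ 0` force `det G[A,B] = 0`. [folklore] -/
theorem minor_AB_eq_zero_two_four {R : Type*} [CommRing R] [NoZeroDivisors R] (G : Matrix (Fin 4) (Fin 4) R)
    (h₂ : (G.submatrix ![0, 1] ![0, 2]).det = 0) (h₃ : (G.submatrix ![0, 1] ![0, 3]).det = 0)
    (hA : (G.submatrix ![0, 1] ![0, 1]).det ≠ 0) :
    (G.submatrix ![0, 1] ![2, 3]).det = 0 :=
  (mul_eq_zero.mp (minor_mul_minor_eq_zero_two_four G h₂ h₃)).resolve_left hA

end Summit.HodgeConjecture.HodgeConjecture.WeilTypeLadder
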